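import Literature.NumberTheory.Automorphic.ArchUnitaryRootVectors           -- ★ A1 p844391 (this seat): root vectors, torus jets
import Mathlib.Analysis.SpecialFunctions.Trigonometric.DerivHyp
import Mathlib.Analysis.SpecialFunctions.Trigonometric.Deriv
import Mathlib.Analysis.Matrix.Normed
import HarnessLib

/-!
# Root one-parameter subgroups of `U(diag e) ≤ GL_N(ℂ)` through a block: the boost `u(s) = 1 + (ch s − 1)P + sh s·X` (`X² = P`) and the rotation `1 + (cos s − 1)P + sin s·X` (`X² = −P`),
# their conjugation curves through a point `γ` and the jets at `s = 0` (Varadarajan 1989 §6.3; Hall GTM 222 §2.1, §3.6) — ★ Z1 `ArchRankOneCasimirTorusPoint` §2 for a block of any `GL_N`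

Topic `NumberTheory/Automorphic`; namespace `Literature.NumberTheory.Automorphic.RootVectors`.  THEOREMS ONLY (no `def`, no instance, no notation, no axiom, no named fact, no `sorry`).
Cell `pub/hodgecm-mathlib`, ENGINE T1 (crux H413 = `stmt-HodgeConjecture-24833`); ROAD A owner word 2026-09-01T12:22:33Z (o2′) «RANK-2 CASIMIR RADIAL EQUATION» (census bac477e2), FILE A2
(abstract in the pair `(X, P)` with `P² = P`, `PX = XP = X`, `X² = ±P`; instantiated by ★ A1's `X̂, Ŷ` (boost, `P = E_ii + E_jj`) and `X, Y` (rotation)).  Author A-p18 (g26), 2026-09-01.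

WHAT IS PROVED (matrix norms from `open scoped Matrix.Norms.Operator`; only the `HasDerivAt` statements depend on the scope).
* §1 BOOST (`X² = P`): `u(s)u(−s) = 1 = u(−s)u(s)`; `u(s)ᴴHu(s) = H` when `XᴴH = −HX`, `Pᴴ = P`, `PH = HP`; `HasDerivAt` of `u`, `u(−·)` and of their derivatives; the conjugation curve
  `c(s) = u(s)γu(−s)`: `HasDerivAt c (c₁ s)`, `HasDerivAt c₁ (c₂ s)`, and `c(0) = γ`, `c₁(0) = Xγ − γX`, `c₂(0) = (Pγ + γP) − 2•XγX`.
* §2 ROTATION (`X² = −P`): the same with `cos∕sin` and `c₂(0) = −(Pγ + γP) − 2•XγX`.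
HONEST LABEL: one-variable calculus and matrix algebra; pays nothing by itself (HC_CM is proved only modulo the printed citations until rung 0 closes).

## References
* [Varadarajan1989] V. S. Varadarajan, *An Introduction to Harmonic Analysis on Semisimple Lie Groups* (1989), §6.3.
* [Hall2015] B. C. Hall, *Lie Groups, Lie Algebras, and Representations*, 2nd ed., GTM 222 (2015), §2.1, §3.6.
-/

set_option autoImplicit false

namespace Literature.NumberTheory.Automorphic.RootVectors

open Complex Matrix
open scoped Matrix.Norms.Operator ComplexConjugate

variable {N : ℕ}

/-! ## §1 The boost through a block: `u(s) = 1 + (ch s − 1)•P + sh s•X`, `X² = P` -/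

section Boost

variable (X P : Matrix (Fin N) (Fin N) ℂ)

/-- `u(s)u(−s) = 1` for the block boost. [cite: Hall2015, §2.1] -/
theorem blockBoost_mul_blockBoost_neg (hPP : P * P = P) (hPX : P * X = X) (hXP : X * P = X) (hXX : X * X = P) (s : ℝ) :
    ((1 : Matrix (Fin N) (Fin N) ℂ) + (cosh (s : ℂ) - 1) • P + sinh (s : ℂ) • X) * ((1 : Matrix (Fin N) (Fin N) ℂ) + (cosh (s : ℂ) - 1) • P - sinh (s : ℂ) • X) = 1 := by
  have h1 := Complex.cosh_sq_sub_sinh_sq (s : ℂ)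
  simp only [add_mul, mul_add, mul_sub, Matrix.smul_mul, Matrix.mul_smul, smul_smul, mul_one, one_mul, hPP, hPX, hXP, hXX]
  linear_combination (norm := module) h1 • P

/-- `u(−s)u(s) = 1` for the block boost. [cite: Hall2015, §2.1] -/
theorem blockBoost_neg_mul_blockBoost (hPP : P * P = P) (hPX : P * X = X) (hXP : X * P = X) (hXX : X * X = P) (s : ℝ) :
    ((1 : Matrix (Fin N) (Fin N) ℂ) + (cosh (s : ℂ) - 1) • P - sinh (s : ℂ) • X) * ((1 : Matrix (Fin N) (Fin N) ℂ) + (cosh (s : ℂ) - 1) • P + sinh (s : ℂ) • X) = 1 := by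
  have h1 := Complex.cosh_sq_sub_sinh_sq (s : ℂ)
  simp only [add_mul, mul_add, sub_mul, Matrix.smul_mul, Matrix.mul_smul, smul_smul, mul_one, one_mul, hPP, hPX, hXP, hXX]
  linear_combination (norm := module) h1 • P

/-- `u(s) ∈ U(H)`: `u(s)ᴴ H u(s) = H` when `XᴴH = −HX`, `Pᴴ = P`, `PH = HP`. [cite: Hall2015, §3.6] -/
theorem star_blockBoost_mul_mul_blockBoost (hPP : P * P = P) (hPX : P * X = X) (hXP : X * P = X) (hXX : X * X = P)
    (H : Matrix (Fin N) (Fin N) ℂ) (hXH : star X * H = -(H * X)) (hPs : star P = P) (hPH : P * H = H * P) (s : ℝ) :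
    star ((1 : Matrix (Fin N) (Fin N) ℂ) + (cosh (s : ℂ) - 1) • P + sinh (s : ℂ) • X) * H * ((1 : Matrix (Fin N) (Fin N) ℂ) + (cosh (s : ℂ) - 1) • P + sinh (s : ℂ) • X) = H := by
  have h1 := Complex.cosh_sq_sub_sinh_sq (s : ℂ)
  have hc : star (cosh (s : ℂ) - 1) = cosh (s : ℂ) - 1 := by rw [star_sub, star_one, ← Complex.ofReal_cosh, Complex.star_def, Complex.conj_ofReal]
  have hs : star (sinh (s : ℂ)) = sinh (s : ℂ) := by rw [← Complex.ofReal_sinh, Complex.star_def, Complex.conj_ofReal]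
  rw [star_add, star_add, star_one, star_smul, star_smul, hc, hs, hPs]
  have e1 : ((1 : Matrix (Fin N) (Fin N) ℂ) + (cosh (s : ℂ) - 1) • P + sinh (s : ℂ) • star X) * H = H + (cosh (s : ℂ) - 1) • (H * P) - sinh (s : ℂ) • (H * X) := by
    rw [add_mul, add_mul, one_mul, Matrix.smul_mul, Matrix.smul_mul, hPH, hXH, smul_neg, ← sub_eq_add_neg]
  rw [e1]
  simp only [add_mul, sub_mul, mul_add, Matrix.smul_mul, Matrix.mul_smul, smul_smul, mul_one, Matrix.mul_assoc, hPP, hPX, hXP, hXX]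
  linear_combination (norm := module) h1 • (H * P)

/-- `u′(s) = sh s•P + ch s•X`. [cite: Hall2015, §2.1] -/
theorem hasDerivAt_blockBoost (s : ℝ) :
    HasDerivAt (fun s : ℝ => (1 : Matrix (Fin N) (Fin N) ℂ) + (cosh (s : ℂ) - 1) • P + sinh (s : ℂ) • X) (sinh (s : ℂ) • P + cosh (s : ℂ) • X) s := by
  exact (((((Complex.hasDerivAt_cosh (s : ℂ)).comp_ofReal).sub_const (1 : ℂ)).smul_const P).const_add (1 : Matrix (Fin N) (Fin N) ℂ)).fun_add
    (((Complex.hasDerivAt_sinh (s : ℂ)).comp_ofReal).smul_const X)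

/-- `(u(−·))′(s) = sh s•P − ch s•X`. [cite: Hall2015, §2.1] -/
theorem hasDerivAt_blockBoost_neg (s : ℝ) :
    HasDerivAt (fun s : ℝ => (1 : Matrix (Fin N) (Fin N) ℂ) + (cosh (s : ℂ) - 1) • P - sinh (s : ℂ) • X) (sinh (s : ℂ) • P - cosh (s : ℂ) • X) s := by
  exact (((((Complex.hasDerivAt_cosh (s : ℂ)).comp_ofReal).sub_const (1 : ℂ)).smul_const P).const_add (1 : Matrix (Fin N) (Fin N) ℂ)).fun_sub
    (((Complex.hasDerivAt_sinh (s : ℂ)).comp_ofReal).smul_const X)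

/-- `u″ = sh′•P + ch′•X`: `d∕ds (sh s•P + ch s•X) = ch s•P + sh s•X`. [cite: Hall2015, §2.1] -/
theorem hasDerivAt_blockBoost_deriv (s : ℝ) :
    HasDerivAt (fun s : ℝ => sinh (s : ℂ) • P + cosh (s : ℂ) • X) (cosh (s : ℂ) • P + sinh (s : ℂ) • X) s :=
  (((Complex.hasDerivAt_sinh (s : ℂ)).comp_ofReal).smul_const P).fun_add (((Complex.hasDerivAt_cosh (s : ℂ)).comp_ofReal).smul_const X)

/-- `d∕ds (sh s•P − ch s•X) = ch s•P − sh s•X`. [cite: Hall2015, §2.1] -/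
theorem hasDerivAt_blockBoost_neg_deriv (s : ℝ) :
    HasDerivAt (fun s : ℝ => sinh (s : ℂ) • P - cosh (s : ℂ) • X) (cosh (s : ℂ) • P - sinh (s : ℂ) • X) s :=
  (((Complex.hasDerivAt_sinh (s : ℂ)).comp_ofReal).smul_const P).fun_sub (((Complex.hasDerivAt_cosh (s : ℂ)).comp_ofReal).smul_const X)

/-- **The boost conjugation curve `c(s) = u(s)γu(−s)` is differentiable**, `c′ = u′γu(−·) + uγ(u(−·))′`. [cite: Varadarajan1989, §6.3] -/
theorem hasDerivAt_conjBlockBoost (γ : Matrix (Fin N) (Fin N) ℂ) (s : ℝ) :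
    HasDerivAt (fun s : ℝ => ((1 : Matrix (Fin N) (Fin N) ℂ) + (cosh (s : ℂ) - 1) • P + sinh (s : ℂ) • X) * γ * ((1 : Matrix (Fin N) (Fin N) ℂ) + (cosh (s : ℂ) - 1) • P - sinh (s : ℂ) • X))
      ((sinh (s : ℂ) • P + cosh (s : ℂ) • X) * γ * ((1 : Matrix (Fin N) (Fin N) ℂ) + (cosh (s : ℂ) - 1) • P - sinh (s : ℂ) • X) +
        ((1 : Matrix (Fin N) (Fin N) ℂ) + (cosh (s : ℂ) - 1) • P + sinh (s : ℂ) • X) * γ * (sinh (s : ℂ) • P - cosh (s : ℂ) • X)) s :=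
  ((hasDerivAt_blockBoost X P s).mul_const γ).mul (hasDerivAt_blockBoost_neg X P s)

/-- … and twice differentiable. [cite: Varadarajan1989, §6.3] -/
theorem hasDerivAt_conjBlockBoost_deriv (γ : Matrix (Fin N) (Fin N) ℂ) (s : ℝ) :
    HasDerivAt (fun s : ℝ => (sinh (s : ℂ) • P + cosh (s : ℂ) • X) * γ * ((1 : Matrix (Fin N) (Fin N) ℂ) + (cosh (s : ℂ) - 1) • P - sinh (s : ℂ) • X) +
        ((1 : Matrix (Fin N) (Fin N) ℂ) + (cosh (s : ℂ) - 1) • P + sinh (s : ℂ) • X) * γ * (sinh (s : ℂ) • P - cosh (s : ℂ) • X))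
      (((cosh (s : ℂ) • P + sinh (s : ℂ) • X) * γ * ((1 : Matrix (Fin N) (Fin N) ℂ) + (cosh (s : ℂ) - 1) • P - sinh (s : ℂ) • X) +
          (sinh (s : ℂ) • P + cosh (s : ℂ) • X) * γ * (sinh (s : ℂ) • P - cosh (s : ℂ) • X)) +
        ((sinh (s : ℂ) • P + cosh (s : ℂ) • X) * γ * (sinh (s : ℂ) • P - cosh (s : ℂ) • X) +
          ((1 : Matrix (Fin N) (Fin N) ℂ) + (cosh (s : ℂ) - 1) • P + sinh (s : ℂ) • X) * γ * (cosh (s : ℂ) • P - sinh (s : ℂ) • X))) s :=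
  (((hasDerivAt_blockBoost_deriv X P s).mul_const γ).mul (hasDerivAt_blockBoost_neg X P s)).add
    (((hasDerivAt_blockBoost X P s).mul_const γ).mul (hasDerivAt_blockBoost_neg_deriv X P s))

/-- `c(0) = γ`. [cite: Varadarajan1989, §6.3] -/
theorem conjBlockBoost_zero (γ : Matrix (Fin N) (Fin N) ℂ) :
    ((1 : Matrix (Fin N) (Fin N) ℂ) + (cosh ((0 : ℝ) : ℂ) - 1) • P + sinh ((0 : ℝ) : ℂ) • X) * γ * ((1 : Matrix (Fin N) (Fin N) ℂ) + (cosh ((0 : ℝ) : ℂ) - 1) • P - sinh ((0 : ℝ) : ℂ) • X) = γ := by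
  simp

/-- `c₁(0) = Xγ − γX`. [cite: Varadarajan1989, §6.3] -/
theorem conjBlockBoost_deriv_zero (γ : Matrix (Fin N) (Fin N) ℂ) :
    (sinh ((0 : ℝ) : ℂ) • P + cosh ((0 : ℝ) : ℂ) • X) * γ * ((1 : Matrix (Fin N) (Fin N) ℂ) + (cosh ((0 : ℝ) : ℂ) - 1) • P - sinh ((0 : ℝ) : ℂ) • X) +
        ((1 : Matrix (Fin N) (Fin N) ℂ) + (cosh ((0 : ℝ) : ℂ) - 1) • P + sinh ((0 : ℝ) : ℂ) • X) * γ * (sinh ((0 : ℝ) : ℂ) • P - cosh ((0 : ℝ) : ℂ) • X) = X * γ - γ * X := by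
  simp [sub_eq_add_neg]

/-- `c₂(0) = (Pγ + γP) − 2•XγX`. [cite: Varadarajan1989, §6.3] -/
theorem conjBlockBoost_deriv_deriv_zero (γ : Matrix (Fin N) (Fin N) ℂ) :
    ((cosh ((0 : ℝ) : ℂ) • P + sinh ((0 : ℝ) : ℂ) • X) * γ * ((1 : Matrix (Fin N) (Fin N) ℂ) + (cosh ((0 : ℝ) : ℂ) - 1) • P - sinh ((0 : ℝ) : ℂ) • X) +
          (sinh ((0 : ℝ) : ℂ) • P + cosh ((0 : ℝ) : ℂ) • X) * γ * (sinh ((0 : ℝ) : ℂ) • P - cosh ((0 : ℝ) : ℂ) • X)) +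
        ((sinh ((0 : ℝ) : ℂ) • P + cosh ((0 : ℝ) : ℂ) • X) * γ * (sinh ((0 : ℝ) : ℂ) • P - cosh ((0 : ℝ) : ℂ) • X) +
          ((1 : Matrix (Fin N) (Fin N) ℂ) + (cosh ((0 : ℝ) : ℂ) - 1) • P + sinh ((0 : ℝ) : ℂ) • X) * γ * (cosh ((0 : ℝ) : ℂ) • P - sinh ((0 : ℝ) : ℂ) • X)) =
      (P * γ + γ * P) - (2 : ℂ) • (X * γ * X) := by
  simp only [Complex.ofReal_zero, Complex.cosh_zero, Complex.sinh_zero, one_smul, zero_smul, sub_self, add_zero, zero_add, zero_sub, sub_zero, mul_one, one_mul,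
    mul_neg, two_smul]
  abel

end Boost

/-! ## §2 The rotation through a block: `u(s) = 1 + (cos s − 1)•P + sin s•X`, `X² = −P` -/

section Rotation

variable (X P : Matrix (Fin N) (Fin N) ℂ)

/-- `u(s)u(−s) = 1` for the block rotation. [cite: Hall2015, §2.1] -/
theorem blockRot_mul_blockRot_neg (hPP : P * P = P) (hPX : P * X = X) (hXP : X * P = X) (hXX : X * X = -P) (s : ℝ) :
    ((1 : Matrix (Fin N) (Fin N) ℂ) + (Complex.cos (s : ℂ) - 1) • P + Complex.sin (s : ℂ) • X) * ((1 : Matrix (Fin N) (Fin N) ℂ) + (Complex.cos (s : ℂ) - 1) • P - Complex.sin (s : ℂ) • X) = 1 := by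
  have h1 := Complex.cos_sq_add_sin_sq (s : ℂ)
  simp only [add_mul, mul_add, mul_sub, Matrix.smul_mul, Matrix.mul_smul, smul_smul, mul_one, one_mul, hPP, hPX, hXP, hXX, smul_neg]
  linear_combination (norm := module) h1 • P

/-- `u(−s)u(s) = 1` for the block rotation. [cite: Hall2015, §2.1] -/
theorem blockRot_neg_mul_blockRot (hPP : P * P = P) (hPX : P * X = X) (hXP : X * P = X) (hXX : X * X = -P) (s : ℝ) :
    ((1 : Matrix (Fin N) (Fin N) ℂ) + (Complex.cos (s : ℂ) - 1) • P - Complex.sin (s : ℂ) • X) * ((1 : Matrix (Fin N) (Fin N) ℂ) + (Complex.cos (s : ℂ) - 1) • P + Complex.sin (s : ℂ) • X) = 1 := by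
  have h1 := Complex.cos_sq_add_sin_sq (s : ℂ)
  simp only [add_mul, mul_add, sub_mul, Matrix.smul_mul, Matrix.mul_smul, smul_smul, mul_one, one_mul, hPP, hPX, hXP, hXX, smul_neg]
  linear_combination (norm := module) h1 • P

/-- `u(s) ∈ U(H)`: `u(s)ᴴ H u(s) = H` for the block rotation when `XᴴH = −HX`, `Pᴴ = P`, `PH = HP`. [cite: Hall2015, §3.6] -/
theorem star_blockRot_mul_mul_blockRot (hPP : P * P = P) (hPX : P * X = X) (hXP : X * P = X) (hXX : X * X = -P)
    (H : Matrix (Fin N) (Fin N) ℂ) (hXH : star X * H = -(H * X)) (hPs : star P = P) (hPH : P * H = H * P) (s : ℝ) :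
    star ((1 : Matrix (Fin N) (Fin N) ℂ) + (Complex.cos (s : ℂ) - 1) • P + Complex.sin (s : ℂ) • X) * H * ((1 : Matrix (Fin N) (Fin N) ℂ) + (Complex.cos (s : ℂ) - 1) • P + Complex.sin (s : ℂ) • X) = H := by
  have h1 := Complex.cos_sq_add_sin_sq (s : ℂ)
  have hc : star (Complex.cos (s : ℂ) - 1) = Complex.cos (s : ℂ) - 1 := by rw [star_sub, star_one, ← Complex.ofReal_cos, Complex.star_def, Complex.conj_ofReal]
  have hs : star (Complex.sin (s : ℂ)) = Complex.sin (s : ℂ) := by rw [← Complex.ofReal_sin, Complex.star_def, Complex.conj_ofReal]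
  rw [star_add, star_add, star_one, star_smul, star_smul, hc, hs, hPs]
  have e1 : ((1 : Matrix (Fin N) (Fin N) ℂ) + (Complex.cos (s : ℂ) - 1) • P + Complex.sin (s : ℂ) • star X) * H = H + (Complex.cos (s : ℂ) - 1) • (H * P) - Complex.sin (s : ℂ) • (H * X) := by
    rw [add_mul, add_mul, one_mul, Matrix.smul_mul, Matrix.smul_mul, hPH, hXH, smul_neg, ← sub_eq_add_neg]
  rw [e1]
  simp only [add_mul, sub_mul, mul_add, Matrix.smul_mul, Matrix.mul_smul, smul_smul, mul_one, Matrix.mul_assoc, hPP, hPX, hXP, hXX, Matrix.mul_neg, smul_neg]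
  linear_combination (norm := module) h1 • (H * P)

/-- `u′(s) = −sin s•P + cos s•X`. [cite: Hall2015, §2.1] -/
theorem hasDerivAt_blockRot (s : ℝ) :
    HasDerivAt (fun s : ℝ => (1 : Matrix (Fin N) (Fin N) ℂ) + (Complex.cos (s : ℂ) - 1) • P + Complex.sin (s : ℂ) • X) ((-(Complex.sin (s : ℂ))) • P + Complex.cos (s : ℂ) • X) s := by
  exact (((((Complex.hasDerivAt_cos (s : ℂ)).comp_ofReal).sub_const (1 : ℂ)).smul_const P).const_add (1 : Matrix (Fin N) (Fin N) ℂ)).fun_add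
    (((Complex.hasDerivAt_sin (s : ℂ)).comp_ofReal).smul_const X)

/-- `(u(−·))′(s) = −sin s•P − cos s•X`. [cite: Hall2015, §2.1] -/
theorem hasDerivAt_blockRot_neg (s : ℝ) :
    HasDerivAt (fun s : ℝ => (1 : Matrix (Fin N) (Fin N) ℂ) + (Complex.cos (s : ℂ) - 1) • P - Complex.sin (s : ℂ) • X) ((-(Complex.sin (s : ℂ))) • P - Complex.cos (s : ℂ) • X) s := by
  exact (((((Complex.hasDerivAt_cos (s : ℂ)).comp_ofReal).sub_const (1 : ℂ)).smul_const P).const_add (1 : Matrix (Fin N) (Fin N) ℂ)).fun_sub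
    (((Complex.hasDerivAt_sin (s : ℂ)).comp_ofReal).smul_const X)

/-- `d∕ds (−sin s•P + cos s•X) = −cos s•P − sin s•X`. [cite: Hall2015, §2.1] -/
theorem hasDerivAt_blockRot_deriv (s : ℝ) :
    HasDerivAt (fun s : ℝ => (-(Complex.sin (s : ℂ))) • P + Complex.cos (s : ℂ) • X) ((-(Complex.cos (s : ℂ))) • P + (-(Complex.sin (s : ℂ))) • X) s :=
  ((((Complex.hasDerivAt_sin (s : ℂ)).comp_ofReal).fun_neg).smul_const P).fun_add (((Complex.hasDerivAt_cos (s : ℂ)).comp_ofReal).smul_const X)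

/-- `d∕ds (−sin s•P − cos s•X) = −cos s•P + sin s•X`. [cite: Hall2015, §2.1] -/
theorem hasDerivAt_blockRot_neg_deriv (s : ℝ) :
    HasDerivAt (fun s : ℝ => (-(Complex.sin (s : ℂ))) • P - Complex.cos (s : ℂ) • X) ((-(Complex.cos (s : ℂ))) • P - (-(Complex.sin (s : ℂ))) • X) s :=
  ((((Complex.hasDerivAt_sin (s : ℂ)).comp_ofReal).fun_neg).smul_const P).fun_sub (((Complex.hasDerivAt_cos (s : ℂ)).comp_ofReal).smul_const X)

/-- **The rotation conjugation curve `c(s) = u(s)γu(−s)` is differentiable**, `c′ = u′γu(−·) + uγ(u(−·))′`. [cite: Varadarajan1989, §6.3] -/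
theorem hasDerivAt_conjBlockRot (γ : Matrix (Fin N) (Fin N) ℂ) (s : ℝ) :
    HasDerivAt (fun s : ℝ => ((1 : Matrix (Fin N) (Fin N) ℂ) + (Complex.cos (s : ℂ) - 1) • P + Complex.sin (s : ℂ) • X) * γ * ((1 : Matrix (Fin N) (Fin N) ℂ) + (Complex.cos (s : ℂ) - 1) • P - Complex.sin (s : ℂ) • X))
      (((-(Complex.sin (s : ℂ))) • P + Complex.cos (s : ℂ) • X) * γ * ((1 : Matrix (Fin N) (Fin N) ℂ) + (Complex.cos (s : ℂ) - 1) • P - Complex.sin (s : ℂ) • X) + ((1 : Matrix (Fin N) (Fin N) ℂ) + (Complex.cos (s : ℂ) - 1) • P + Complex.sin (s : ℂ) • X) * γ * ((-(Complex.sin (s : ℂ))) • P - Complex.cos (s : ℂ) • X)) s :=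
  ((hasDerivAt_blockRot X P s).mul_const γ).mul (hasDerivAt_blockRot_neg X P s)

/-- … and twice differentiable. [cite: Varadarajan1989, §6.3] -/
theorem hasDerivAt_conjBlockRot_deriv (γ : Matrix (Fin N) (Fin N) ℂ) (s : ℝ) :
    HasDerivAt (fun s : ℝ => ((-(Complex.sin (s : ℂ))) • P + Complex.cos (s : ℂ) • X) * γ * ((1 : Matrix (Fin N) (Fin N) ℂ) + (Complex.cos (s : ℂ) - 1) • P - Complex.sin (s : ℂ) • X) + ((1 : Matrix (Fin N) (Fin N) ℂ) + (Complex.cos (s : ℂ) - 1) • P + Complex.sin (s : ℂ) • X) * γ * ((-(Complex.sin (s : ℂ))) • P - Complex.cos (s : ℂ) • X))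
      ((((-(Complex.cos (s : ℂ))) • P + (-(Complex.sin (s : ℂ))) • X) * γ * ((1 : Matrix (Fin N) (Fin N) ℂ) + (Complex.cos (s : ℂ) - 1) • P - Complex.sin (s : ℂ) • X) + ((-(Complex.sin (s : ℂ))) • P + Complex.cos (s : ℂ) • X) * γ * ((-(Complex.sin (s : ℂ))) • P - Complex.cos (s : ℂ) • X)) +
        (((-(Complex.sin (s : ℂ))) • P + Complex.cos (s : ℂ) • X) * γ * ((-(Complex.sin (s : ℂ))) • P - Complex.cos (s : ℂ) • X) + ((1 : Matrix (Fin N) (Fin N) ℂ) + (Complex.cos (s : ℂ) - 1) • P + Complex.sin (s : ℂ) • X) * γ * ((-(Complex.cos (s : ℂ))) • P - (-(Complex.sin (s : ℂ))) • X))) s :=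
  (((hasDerivAt_blockRot_deriv X P s).mul_const γ).mul (hasDerivAt_blockRot_neg X P s)).add
    (((hasDerivAt_blockRot X P s).mul_const γ).mul (hasDerivAt_blockRot_neg_deriv X P s))

/-- `c(0) = γ` (rotation). [cite: Varadarajan1989, §6.3] -/
theorem conjBlockRot_zero (γ : Matrix (Fin N) (Fin N) ℂ) : ((1 : Matrix (Fin N) (Fin N) ℂ) + (Complex.cos ((0 : ℝ) : ℂ) - 1) • P + Complex.sin ((0 : ℝ) : ℂ) • X) * γ * ((1 : Matrix (Fin N) (Fin N) ℂ) + (Complex.cos ((0 : ℝ) : ℂ) - 1) • P - Complex.sin ((0 : ℝ) : ℂ) • X) = γ := by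
  simp

/-- `c₁(0) = Xγ − γX` (rotation). [cite: Varadarajan1989, §6.3] -/
theorem conjBlockRot_deriv_zero (γ : Matrix (Fin N) (Fin N) ℂ) :
    ((-(Complex.sin ((0 : ℝ) : ℂ))) • P + Complex.cos ((0 : ℝ) : ℂ) • X) * γ * ((1 : Matrix (Fin N) (Fin N) ℂ) + (Complex.cos ((0 : ℝ) : ℂ) - 1) • P - Complex.sin ((0 : ℝ) : ℂ) • X) + ((1 : Matrix (Fin N) (Fin N) ℂ) + (Complex.cos ((0 : ℝ) : ℂ) - 1) • P + Complex.sin ((0 : ℝ) : ℂ) • X) * γ * ((-(Complex.sin ((0 : ℝ) : ℂ))) • P - Complex.cos ((0 : ℝ) : ℂ) • X) = X * γ - γ * X := by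
  simp [sub_eq_add_neg]

/-- `c₂(0) = −(Pγ + γP) − 2•XγX` (rotation). [cite: Varadarajan1989, §6.3] -/
theorem conjBlockRot_deriv_deriv_zero (γ : Matrix (Fin N) (Fin N) ℂ) :
    (((-(Complex.cos ((0 : ℝ) : ℂ))) • P + (-(Complex.sin ((0 : ℝ) : ℂ))) • X) * γ * ((1 : Matrix (Fin N) (Fin N) ℂ) + (Complex.cos ((0 : ℝ) : ℂ) - 1) • P - Complex.sin ((0 : ℝ) : ℂ) • X) + ((-(Complex.sin ((0 : ℝ) : ℂ))) • P + Complex.cos ((0 : ℝ) : ℂ) • X) * γ * ((-(Complex.sin ((0 : ℝ) : ℂ))) • P - Complex.cos ((0 : ℝ) : ℂ) • X)) +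
        (((-(Complex.sin ((0 : ℝ) : ℂ))) • P + Complex.cos ((0 : ℝ) : ℂ) • X) * γ * ((-(Complex.sin ((0 : ℝ) : ℂ))) • P - Complex.cos ((0 : ℝ) : ℂ) • X) + ((1 : Matrix (Fin N) (Fin N) ℂ) + (Complex.cos ((0 : ℝ) : ℂ) - 1) • P + Complex.sin ((0 : ℝ) : ℂ) • X) * γ * ((-(Complex.cos ((0 : ℝ) : ℂ))) • P - (-(Complex.sin ((0 : ℝ) : ℂ))) • X)) = -(P * γ + γ * P) - (2 : ℂ) • (X * γ * X) := by
  simp only [Complex.ofReal_zero, Complex.cos_zero, Complex.sin_zero, neg_zero, one_smul, zero_smul, neg_smul, sub_self, add_zero, zero_add, zero_sub, sub_zero,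
    mul_one, one_mul, mul_neg, neg_mul, two_smul]
  abel

end Rotation

end Literature.NumberTheory.Automorphic.RootVectors
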